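import Mathlib
import HarnessLib
import Summits.HubbardSuperconductivity.HubbardSuperconductivity.Theorems.KLProgrammeC4aPPKernelOneSided

/-!
# Route `KLProgramme` — crux C4a, S3 brick (B4) «(B4)-UMK1», «(M1)-K2-PACKAGE» part 3: the ROWS of the one-sided split kernel `K⁺` for the positive-level pre-caustic law —
# `hK0/hK1/hK2` envelopes `κ₀/max`, `C₁/max²`, `C₂/max³`, the one-sided support `u ≤ q_s·e ⇒ K⁺′ = 0`, and the JOINT CONTINUITY `hKc`

Cell `gate-hubbard-kl`, seat hubbard-kl-k3c3-p1 (g16; row «δμ-flow with klAngularMean constant piece»).  Located brick for the (U1) chain of hubbard-kl-k3c3-p3 (the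
positive-level `hpre` law `…C4aFoldBoxPreLaw.intervalIntegral_partnerBand_pre_le`) / the (C)-closer lane (stub (C) `stub_twoLeg_curvature` of `KLRegimeEngineV17F2`,
stmt-HubbardSuperconductivity-20437); parts 1–2 = `…C4aPPKernelSplitFactor`, `…C4aPPKernelOneSided`; memo HOME/hubbard-kl-k3c3-p1/g16-M1-NEG-PRE-KERNEL.md §5.

* §2 envelopes (`e > 0`, all `u`): **`abs_ppOneSidedKernel_le`** `κ₀·(max e |u|)⁻¹` (`hK0`), **`abs_ppOneSidedKernelD1_le`** / **`abs_deriv_ppOneSidedKernel_le`**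
  `C₁·(max e |u|)⁻¹²`, `C₁ = κ₀(6B₁+5/2)/(1−t₁) + κ₀ + κ₁` (`hK1`), **`abs_ppOneSidedKernelD2_le`** / **`abs_iteratedDeriv_two_ppOneSidedKernel_le`** `C₂·(max e |u|)⁻¹³`,
  `C₂ = κ₀(16B₂+24B₁+33)/(1−t₁)² + 2(κ₀+κ₁)(6B₁+5/2)/(1−t₁) + 2κ₀ + 4κ₁ + κ₂` (`hK2`) — the `N`-sizes of `…TrueEnvelope`/`…TrueSignedDeriv` on the support
  `(1−t₁)(e+u) ≤ u` (`|N| ≤ 1`, `|N′|(e+u) ≤ (6B₁+5/2)/(1−t₁)`, `|N″| ≤ (64B₂+96B₁+132)/M²` with `M = 2(1−t₁)(e+u) ≤ 2u`) times the `R`-sizes of part 1;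
* §3 **`deriv_ppOneSidedKernel_eq_zero_of_le`** (`hsupp` with `q_s = (1−t₁)/t₁`);
* §4 **`continuous_ppOneSidedKernelD1_comp`** (`x ↦ K⁺′(f x, g x)` continuous for continuous `f > 0`, `g`: near `g > 0` it is `N′R + NR′` along the level maps, near
  `g ≤ 0` it vanishes on the open set `g < f(1−t₁)/t₁`) and **`continuous_deriv_ppOneSidedKernel_clamp`**: `p ↦ deriv (K⁺(max p.1 c, ·)) p.2` is continuous on `ℝ × ℝ`
  for any `c > 0` — the `hKc` row for `Kr e := K⁺(max e c, ·)` (`= K⁺(e,·)` for `e ≥ c`, e.g. `c = lo`).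
USE (closer): `Kr e u := ppOneSidedKernel β Λ κ (max e lo) u / C` with `C = max(κ₀, C₁, C₂)` meets `hK`, `hK1`, `hK2`, `hsupp`, `hKc` of `intervalIntegral_partnerBand_pre_le`
for every `e ∈ [lo,hi]` (there `max e lo = e`); `hflat` is this seat's `…TrueFlatnessShape`/`…AntidiagonalFlatnessWeighted` instance for the same kernel.
Pure real analysis on Literature objects; nothing asserts (C), K3, the window or superconductivity.
References: BGM 2006 §2.4 (2.36) [cite: BenfattoGiulianiMastropietro2006]; Salmhofer 1999 §4.2.5 (4.70)–(4.71) [cite: Salmhofer1999];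
FST II CPAM 51 (1998) §3 [cite: FeldmanSalmhoferTrubowitz1998].
-/

noncomputable section

namespace Summit.HubbardSuperconductivity.HubbardSuperconductivity.Theorems.C4a

set_option linter.dupNamespace false -- summit = problem name (single-conjunct summit), D-0017

open Real Filter Set
open scoped Topology
open Literature.MathematicalPhysics.QuantumLattice Literature.Analysis.SpecialFunctions

section Kernel

variable {β Λ : ℝ} (hβ : 0 < β) (hΛ : 0 < Λ) {B₁ B₂ : ℝ} (hB₁ : ∀ x, |deriv salmhoferCutoff x| ≤ B₁) (hB₂ : ∀ x, |deriv (deriv salmhoferCutoff) x| ≤ B₂)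
  {κ κ' κ'' : ℝ → ℝ} (hκ : ∀ t, HasDerivAt κ (κ' t) t) (hκ' : ∀ t, HasDerivAt κ' (κ'' t) t)
  {t₁ : ℝ} (ht₀ : 0 < t₁) (ht₁ : t₁ < 1) (hκs : ∀ t, t₁ ≤ t → κ t = 0) (hκ's : ∀ t, t₁ ≤ t → κ' t = 0) (hκ''s : ∀ t, t₁ ≤ t → κ'' t = 0)
  {e : ℝ} (he : 0 < e)

/-! ## §2 The three envelopes -/

/-- On the support side `e(1−t₁)/t₁ < u` the support condition `(1−t₁)(e+u) ≤ u` of `…TrueEnvelope` holds. [folklore] -/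
theorem oneSided_support_of_lt {t₁ e u : ℝ} (ht₀ : 0 < t₁) (hu : e * (1 - t₁) / t₁ ≤ u) : (1 - t₁) * (e + u) ≤ u := by
  have h := mul_le_mul_of_nonneg_left hu ht₀.le
  rw [mul_div_cancel₀ _ ht₀.ne'] at h
  nlinarith

include hβ he in
/-- **ROW `hK0`**: `|K⁺(e,u)| ≤ κ₀·(max e |u|)⁻¹` for every `u` (`|N| ≤ 1`, `|R| ≤ κ₀/(e+u)`, `1/(e+u) ≤ (max e |u|)⁻¹`). [cite: BenfattoGiulianiMastropietro2006, §2.4 (2.36)] -/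
theorem abs_ppOneSidedKernel_le {κ₀ : ℝ} (hκb : ∀ t ∈ Icc 0 1, |κ t| ≤ κ₀) (u : ℝ) : |ppOneSidedKernel β Λ κ e u| ≤ κ₀ * (max e |u|)⁻¹ := by
  have hκ₀ : 0 ≤ κ₀ := (abs_nonneg _).trans (hκb 0 (left_mem_Icc.2 zero_le_one))
  have hM : 0 < max e |u| := he.trans_le (le_max_left _ _)
  unfold ppOneSidedKernel
  by_cases h0 : 0 < u
  · rw [if_pos h0, abs_mul]
    have hs : 0 < e + u := by linarith
    have h1 := abs_ppTrueNumerator_le_one hβ Λ e u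
    have h2 := abs_splitR_le hκb he.le h0
    have h3 := inv_add_le_inv_max he.le h0
    calc |ppTrueNumerator β Λ e u| * |κ (e / (e + u)) / (e + u)| ≤ 1 * (κ₀ / (e + u)) := mul_le_mul h1 h2 (abs_nonneg _) zero_le_one
      _ = κ₀ * (1 / (e + u)) := by ring
      _ ≤ κ₀ * (max e |u|)⁻¹ := mul_le_mul_of_nonneg_left h3 hκ₀
  · rw [if_neg h0, abs_zero]; positivity

include hβ hΛ hB₁ ht₀ ht₁ hκs hκ's he in
/-- **ROW `hK1`**: `|K⁺′(e,u)| ≤ C₁·(max e |u|)⁻¹²`, `C₁ = κ₀(6B₁+5/2)/(1−t₁) + κ₀ + κ₁`, for every `u` (below the threshold `K⁺′ = 0`; above it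
`|N′|(e+u) ≤ (6B₁+5/2)/(1−t₁)` and `|R′| ≤ (κ₀+κ₁)/(e+u)²`). [cite: BenfattoGiulianiMastropietro2006, §2.4 (2.36)] -/
theorem abs_ppOneSidedKernelD1_le {κ₀ κ₁ : ℝ} (hκb : ∀ t ∈ Icc 0 1, |κ t| ≤ κ₀) (hκ'b : ∀ t ∈ Icc 0 1, |κ' t| ≤ κ₁) (u : ℝ) :
    |ppOneSidedKernelD1 β Λ κ κ' e u| ≤ (κ₀ * ((6 * B₁ + 5 / 2) / (1 - t₁)) + κ₀ + κ₁) * (max e |u|)⁻¹ ^ 2 := by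
  have hB0 := salmhoferB₁_nonneg hB₁
  have h1t : 0 < 1 - t₁ := by linarith
  have hκ₀ : 0 ≤ κ₀ := (abs_nonneg _).trans (hκb 0 (left_mem_Icc.2 zero_le_one))
  have hκ₁ : 0 ≤ κ₁ := (abs_nonneg _).trans (hκ'b 0 (left_mem_Icc.2 zero_le_one))
  have hM : 0 < max e |u| := he.trans_le (le_max_left _ _)
  have hC : 0 ≤ κ₀ * ((6 * B₁ + 5 / 2) / (1 - t₁)) + κ₀ + κ₁ := by positivity
  rcases le_or_gt u (e * (1 - t₁) / t₁) with hlow | hhigh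
  · rw [ppOneSidedKernelD1_eq_zero_of_le ht₀ hκs hκ's he hlow, abs_zero]; positivity
  · have hthr := oneSided_threshold_pos ht₀ ht₁ he
    have h0 : 0 < u := hthr.trans hhigh
    have hs : 0 < e + u := by linarith
    have hsupp := oneSided_support_of_lt ht₀ hhigh.le
    unfold ppOneSidedKernelD1
    rw [if_pos h0]
    have hN := abs_ppTrueNumerator_le_one hβ Λ e u
    have hN' := abs_ppTrueNumeratorDu_mul_le_of_support hβ hΛ hB₁ ht₁ he.le h0 hsupp
    have hR := abs_splitR_le hκb he.le h0
    have hR' := abs_splitR1_le hκb hκ'b he.le h0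
    have hinv := inv_add_le_inv_max he.le h0
    have hinv2 : 1 / (e + u) ^ 2 ≤ (max e |u|)⁻¹ ^ 2 := by
      calc 1 / (e + u) ^ 2 = (1 / (e + u)) ^ 2 := by rw [one_div_pow]
        _ ≤ (max e |u|)⁻¹ ^ 2 := pow_le_pow_left₀ (by positivity) hinv 2
    have hA : |ppTrueNumeratorDu β Λ e u * (κ (e / (e + u)) / (e + u))| ≤ κ₀ * ((6 * B₁ + 5 / 2) / (1 - t₁)) * (1 / (e + u) ^ 2) := by
      rw [abs_mul]
      have h1 : |ppTrueNumeratorDu β Λ e u| ≤ (6 * B₁ + 5 / 2) / (1 - t₁) / (e + u) := by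
        rw [le_div_iff₀ hs]; exact hN'
      calc |ppTrueNumeratorDu β Λ e u| * |κ (e / (e + u)) / (e + u)| ≤ (6 * B₁ + 5 / 2) / (1 - t₁) / (e + u) * (κ₀ / (e + u)) :=
            mul_le_mul h1 hR (abs_nonneg _) (by positivity)
        _ = κ₀ * ((6 * B₁ + 5 / 2) / (1 - t₁)) * (1 / (e + u) ^ 2) := by field_simp
    have hB : |ppTrueNumerator β Λ e u * (-(κ' (e / (e + u)) * (e / (e + u)) + κ (e / (e + u))) / (e + u) ^ 2)| ≤ (κ₀ + κ₁) * (1 / (e + u) ^ 2) := by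
      rw [abs_mul]
      calc |ppTrueNumerator β Λ e u| * |-(κ' (e / (e + u)) * (e / (e + u)) + κ (e / (e + u))) / (e + u) ^ 2| ≤ 1 * ((κ₀ + κ₁) / (e + u) ^ 2) :=
            mul_le_mul hN hR' (abs_nonneg _) zero_le_one
        _ = (κ₀ + κ₁) * (1 / (e + u) ^ 2) := by field_simp
    calc |ppTrueNumeratorDu β Λ e u * (κ (e / (e + u)) / (e + u)) +
            ppTrueNumerator β Λ e u * (-(κ' (e / (e + u)) * (e / (e + u)) + κ (e / (e + u))) / (e + u) ^ 2)|
        ≤ κ₀ * ((6 * B₁ + 5 / 2) / (1 - t₁)) * (1 / (e + u) ^ 2) + (κ₀ + κ₁) * (1 / (e + u) ^ 2) := (abs_add_le _ _).trans (add_le_add hA hB)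
      _ = (κ₀ * ((6 * B₁ + 5 / 2) / (1 - t₁)) + κ₀ + κ₁) * (1 / (e + u) ^ 2) := by ring
      _ ≤ (κ₀ * ((6 * B₁ + 5 / 2) / (1 - t₁)) + κ₀ + κ₁) * (max e |u|)⁻¹ ^ 2 := mul_le_mul_of_nonneg_left hinv2 hC

include hβ hΛ hB₁ hB₂ ht₀ ht₁ hκs hκ's hκ''s he in
/-- **ROW `hK2`**: `|K⁺″(e,u)| ≤ C₂·(max e |u|)⁻¹³`, `C₂ = κ₀(16B₂+24B₁+33)/(1−t₁)² + 2(κ₀+κ₁)(6B₁+5/2)/(1−t₁) + 2κ₀ + 4κ₁ + κ₂`, for every `u`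
(above the threshold `|N″| ≤ (64B₂+96B₁+132)/M²` with `M = 2(1−t₁)(e+u) ≤ 2u`). [cite: BenfattoGiulianiMastropietro2006, §2.4 (2.36)] -/
theorem abs_ppOneSidedKernelD2_le {κ₀ κ₁ κ₂ : ℝ} (hκb : ∀ t ∈ Icc 0 1, |κ t| ≤ κ₀) (hκ'b : ∀ t ∈ Icc 0 1, |κ' t| ≤ κ₁) (hκ''b : ∀ t ∈ Icc 0 1, |κ'' t| ≤ κ₂)
    (u : ℝ) : |ppOneSidedKernelD2 β Λ κ κ' κ'' e u| ≤
      (κ₀ * ((16 * B₂ + 24 * B₁ + 33) / (1 - t₁) ^ 2) + 2 * (κ₀ + κ₁) * ((6 * B₁ + 5 / 2) / (1 - t₁)) + (2 * κ₀ + 4 * κ₁ + κ₂)) * (max e |u|)⁻¹ ^ 3 := by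
  have hB0 := salmhoferB₁_nonneg hB₁
  have hB20 := salmhoferB₂_nonneg hB₂
  have h1t : 0 < 1 - t₁ := by linarith
  have hκ₀ : 0 ≤ κ₀ := (abs_nonneg _).trans (hκb 0 (left_mem_Icc.2 zero_le_one))
  have hκ₁ : 0 ≤ κ₁ := (abs_nonneg _).trans (hκ'b 0 (left_mem_Icc.2 zero_le_one))
  have hκ₂ : 0 ≤ κ₂ := (abs_nonneg _).trans (hκ''b 0 (left_mem_Icc.2 zero_le_one))
  have hM : 0 < max e |u| := he.trans_le (le_max_left _ _)
  have hC : 0 ≤ κ₀ * ((16 * B₂ + 24 * B₁ + 33) / (1 - t₁) ^ 2) + 2 * (κ₀ + κ₁) * ((6 * B₁ + 5 / 2) / (1 - t₁)) + (2 * κ₀ + 4 * κ₁ + κ₂) := by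
    positivity
  rcases le_or_gt u (e * (1 - t₁) / t₁) with hlow | hhigh
  · rw [ppOneSidedKernelD2_eq_zero_of_le ht₀ hκs hκ's hκ''s he hlow, abs_zero]; positivity
  · have hthr := oneSided_threshold_pos ht₀ ht₁ he
    have h0 : 0 < u := hthr.trans hhigh
    have hs : 0 < e + u := by linarith
    have hsupp := oneSided_support_of_lt ht₀ hhigh.le
    unfold ppOneSidedKernelD2
    rw [if_pos h0]
    have hN := abs_ppTrueNumerator_le_one hβ Λ e u
    have hN' := abs_ppTrueNumeratorDu_mul_le_of_support hβ hΛ hB₁ ht₁ he.le h0 hsupp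
    have hN'' : |ppTrueNumeratorDuu β Λ e u| ≤ (16 * B₂ + 24 * B₁ + 33) / (1 - t₁) ^ 2 / (e + u) ^ 2 := by
      have hMv : 2 * (1 - t₁) * (e + u) ≤ 2 * |u| := by rw [abs_of_pos h0]; linarith
      have h := abs_ppTrueNumeratorDuu_le_of_scale hβ hΛ hB₁ hB₂ (by positivity : 0 < 2 * (1 - t₁) * (e + u)) hMv e
      refine h.trans (le_of_eq ?_)
      field_simp
      ring
    have hR := abs_splitR_le hκb he.le h0
    have hR' := abs_splitR1_le hκb hκ'b he.le h0
    have hR'' := abs_splitR2_le hκb hκ'b hκ''b he.le h0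
    have hinv := inv_add_le_inv_max he.le h0
    have hinv3 : 1 / (e + u) ^ 3 ≤ (max e |u|)⁻¹ ^ 3 := by
      calc 1 / (e + u) ^ 3 = (1 / (e + u)) ^ 3 := by rw [one_div_pow]
        _ ≤ (max e |u|)⁻¹ ^ 3 := pow_le_pow_left₀ (by positivity) hinv 3
    have hA : |ppTrueNumeratorDuu β Λ e u * (κ (e / (e + u)) / (e + u))| ≤ κ₀ * ((16 * B₂ + 24 * B₁ + 33) / (1 - t₁) ^ 2) * (1 / (e + u) ^ 3) := by
      rw [abs_mul]
      calc |ppTrueNumeratorDuu β Λ e u| * |κ (e / (e + u)) / (e + u)| ≤ (16 * B₂ + 24 * B₁ + 33) / (1 - t₁) ^ 2 / (e + u) ^ 2 * (κ₀ / (e + u)) :=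
            mul_le_mul hN'' hR (abs_nonneg _) (by positivity)
        _ = κ₀ * ((16 * B₂ + 24 * B₁ + 33) / (1 - t₁) ^ 2) * (1 / (e + u) ^ 3) := by field_simp
    have hB : |2 * ppTrueNumeratorDu β Λ e u * (-(κ' (e / (e + u)) * (e / (e + u)) + κ (e / (e + u))) / (e + u) ^ 2)| ≤
        2 * (κ₀ + κ₁) * ((6 * B₁ + 5 / 2) / (1 - t₁)) * (1 / (e + u) ^ 3) := by
      rw [abs_mul, abs_mul, abs_of_pos (by norm_num : (0 : ℝ) < 2)]
      have h1 : |ppTrueNumeratorDu β Λ e u| ≤ (6 * B₁ + 5 / 2) / (1 - t₁) / (e + u) := by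
        rw [le_div_iff₀ hs]; exact hN'
      calc 2 * |ppTrueNumeratorDu β Λ e u| * |-(κ' (e / (e + u)) * (e / (e + u)) + κ (e / (e + u))) / (e + u) ^ 2|
          ≤ 2 * ((6 * B₁ + 5 / 2) / (1 - t₁) / (e + u)) * ((κ₀ + κ₁) / (e + u) ^ 2) := by gcongr
        _ = 2 * (κ₀ + κ₁) * ((6 * B₁ + 5 / 2) / (1 - t₁)) * (1 / (e + u) ^ 3) := by field_simp
    have hCC : |ppTrueNumerator β Λ e u *
        ((κ'' (e / (e + u)) * (e / (e + u)) ^ 2 + 4 * κ' (e / (e + u)) * (e / (e + u)) + 2 * κ (e / (e + u))) / (e + u) ^ 3)| ≤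
        (2 * κ₀ + 4 * κ₁ + κ₂) * (1 / (e + u) ^ 3) := by
      rw [abs_mul]
      calc |ppTrueNumerator β Λ e u| *
            |(κ'' (e / (e + u)) * (e / (e + u)) ^ 2 + 4 * κ' (e / (e + u)) * (e / (e + u)) + 2 * κ (e / (e + u))) / (e + u) ^ 3|
          ≤ 1 * ((2 * κ₀ + 4 * κ₁ + κ₂) / (e + u) ^ 3) := mul_le_mul hN hR'' (abs_nonneg _) zero_le_one
        _ = (2 * κ₀ + 4 * κ₁ + κ₂) * (1 / (e + u) ^ 3) := by field_simp
    calc |ppTrueNumeratorDuu β Λ e u * (κ (e / (e + u)) / (e + u)) +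
            2 * ppTrueNumeratorDu β Λ e u * (-(κ' (e / (e + u)) * (e / (e + u)) + κ (e / (e + u))) / (e + u) ^ 2) +
            ppTrueNumerator β Λ e u *
              ((κ'' (e / (e + u)) * (e / (e + u)) ^ 2 + 4 * κ' (e / (e + u)) * (e / (e + u)) + 2 * κ (e / (e + u))) / (e + u) ^ 3)|
        ≤ κ₀ * ((16 * B₂ + 24 * B₁ + 33) / (1 - t₁) ^ 2) * (1 / (e + u) ^ 3) + 2 * (κ₀ + κ₁) * ((6 * B₁ + 5 / 2) / (1 - t₁)) * (1 / (e + u) ^ 3) +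
            (2 * κ₀ + 4 * κ₁ + κ₂) * (1 / (e + u) ^ 3) :=
          (abs_add_le _ _).trans (add_le_add ((abs_add_le _ _).trans (add_le_add hA hB)) hCC)
      _ = (κ₀ * ((16 * B₂ + 24 * B₁ + 33) / (1 - t₁) ^ 2) + 2 * (κ₀ + κ₁) * ((6 * B₁ + 5 / 2) / (1 - t₁)) + (2 * κ₀ + 4 * κ₁ + κ₂)) *
            (1 / (e + u) ^ 3) := by ring
      _ ≤ _ := mul_le_mul_of_nonneg_left hinv3 hC

include hβ hΛ hB₁ hκ ht₀ ht₁ hκs hκ's he in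
/-- **ROW `hK1` in `deriv` form.** [cite: BenfattoGiulianiMastropietro2006, §2.4 (2.36)] -/
theorem abs_deriv_ppOneSidedKernel_le {κ₀ κ₁ : ℝ} (hκb : ∀ t ∈ Icc 0 1, |κ t| ≤ κ₀) (hκ'b : ∀ t ∈ Icc 0 1, |κ' t| ≤ κ₁) (u : ℝ) :
    |deriv (fun v : ℝ => ppOneSidedKernel β Λ κ e v) u| ≤ (κ₀ * ((6 * B₁ + 5 / 2) / (1 - t₁)) + κ₀ + κ₁) * (max e |u|)⁻¹ ^ 2 := by
  rw [deriv_ppOneSidedKernel hβ hΛ hB₁ hκ ht₀ ht₁ hκs he]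
  exact abs_ppOneSidedKernelD1_le hβ hΛ hB₁ ht₀ ht₁ hκs hκ's he hκb hκ'b u

include hβ hΛ hB₁ hB₂ hκ hκ' ht₀ ht₁ hκs hκ's hκ''s he in
/-- **ROW `hK2` in `iteratedDeriv 2` form.** [cite: BenfattoGiulianiMastropietro2006, §2.4 (2.36)] -/
theorem abs_iteratedDeriv_two_ppOneSidedKernel_le {κ₀ κ₁ κ₂ : ℝ} (hκb : ∀ t ∈ Icc 0 1, |κ t| ≤ κ₀) (hκ'b : ∀ t ∈ Icc 0 1, |κ' t| ≤ κ₁)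
    (hκ''b : ∀ t ∈ Icc 0 1, |κ'' t| ≤ κ₂) (u : ℝ) :
    |iteratedDeriv 2 (fun v : ℝ => ppOneSidedKernel β Λ κ e v) u| ≤
      (κ₀ * ((16 * B₂ + 24 * B₁ + 33) / (1 - t₁) ^ 2) + 2 * (κ₀ + κ₁) * ((6 * B₁ + 5 / 2) / (1 - t₁)) + (2 * κ₀ + 4 * κ₁ + κ₂)) * (max e |u|)⁻¹ ^ 3 := by
  rw [iteratedDeriv_two_ppOneSidedKernel hβ hΛ hB₁ hB₂ hκ hκ' ht₀ ht₁ hκs hκ's he]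
  exact abs_ppOneSidedKernelD2_le hβ hΛ hB₁ hB₂ ht₀ ht₁ hκs hκ's hκ''s he hκb hκ'b hκ''b u

/-! ## §3 The one-sided support -/

include hβ hΛ hB₁ hκ ht₀ ht₁ hκs hκ's he in
/-- **ROW `hsupp`** with `q_s = (1−t₁)/t₁`: `u ≤ ((1−t₁)/t₁)·e ⟹ deriv K⁺(e,·) u = 0`. [cite: BenfattoGiulianiMastropietro2006, §2.4 (2.36)] -/
theorem deriv_ppOneSidedKernel_eq_zero_of_le {u : ℝ} (hu : u ≤ (1 - t₁) / t₁ * e) : deriv (fun v : ℝ => ppOneSidedKernel β Λ κ e v) u = 0 := by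
  rw [deriv_ppOneSidedKernel hβ hΛ hB₁ hκ ht₀ ht₁ hκs he]
  exact ppOneSidedKernelD1_eq_zero_of_le ht₀ hκs hκ's he (by rw [div_mul_eq_mul_div, mul_comm] at hu; exact hu)

end Kernel

/-! ## §4 Joint continuity of `K⁺′` along continuous level maps (`hKc`) -/

/-- **`x ↦ K⁺′(f x, g x)` is continuous** for continuous `f > 0` and `g`: near a point with `g > 0` it is the continuous `N′R + NR′` (part 1 §2 and the `R`-calculus),
near a point with `g ≤ 0` it vanishes identically (`g < f(1−t₁)/t₁` is open). [cite: BenfattoGiulianiMastropietro2006, §2.4 (2.36)] -/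
theorem continuous_ppOneSidedKernelD1_comp {β Λ : ℝ} (hβ : 0 < β) (hΛ : 0 < Λ) {B₁ : ℝ} (hB₁ : ∀ x, |deriv salmhoferCutoff x| ≤ B₁) {κ κ' : ℝ → ℝ}
    (hκ : ∀ t, HasDerivAt κ (κ' t) t) (hκ'c : Continuous κ') {t₁ : ℝ} (ht₀ : 0 < t₁) (ht₁ : t₁ < 1) (hκs : ∀ t, t₁ ≤ t → κ t = 0)
    (hκ's : ∀ t, t₁ ≤ t → κ' t = 0) {X : Type*} [TopologicalSpace X] {f g : X → ℝ} (hf : Continuous f) (hg : Continuous g) (hf0 : ∀ x, 0 < f x) :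
    Continuous fun x : X => ppOneSidedKernelD1 β Λ κ κ' (f x) (g x) := by
  have hκc : Continuous κ := continuous_iff_continuousAt.2 fun t => (hκ t).continuousAt
  have h1t : 0 < 1 - t₁ := by linarith
  refine continuous_iff_continuousAt.2 fun x₀ => ?_
  by_cases h0 : 0 < g x₀
  · -- near `x₀` the partner level is positive: `K⁺′ = N′R + NR′`
    have hU : IsOpen {x : X | 0 < g x} := isOpen_lt continuous_const hg
    have hs0 : ∀ x ∈ {x : X | 0 < g x}, f x + g x ≠ 0 := fun x hx => by have := hf0 x; have : 0 < g x := hx; linarith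
    have hN : Continuous fun x : X => ppTrueNumerator β Λ (f x) (g x) := continuous_ppTrueNumerator_comp hβ Λ hf hg
    have hN' : Continuous fun x : X => ppTrueNumeratorDu β Λ (f x) (g x) := continuous_ppTrueNumeratorDu_comp hβ hΛ hB₁ hf hg
    have ha : ContinuousOn (fun x : X => f x / (f x + g x)) {x : X | 0 < g x} := ContinuousOn.div hf.continuousOn (hf.add hg).continuousOn hs0
    have hT : ContinuousOn (fun x : X =>
        ppTrueNumeratorDu β Λ (f x) (g x) * (κ (f x / (f x + g x)) / (f x + g x)) +
          ppTrueNumerator β Λ (f x) (g x) * (-(κ' (f x / (f x + g x)) * (f x / (f x + g x)) + κ (f x / (f x + g x))) / (f x + g x) ^ 2))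
        {x : X | 0 < g x} := by
      refine (hN'.continuousOn.mul ((hκc.comp_continuousOn ha).div (hf.add hg).continuousOn hs0)).add (hN.continuousOn.mul ?_)
      refine ContinuousOn.div (((hκ'c.comp_continuousOn ha).mul ha).add (hκc.comp_continuousOn ha)).neg (by fun_prop) fun x hx => pow_ne_zero 2 (hs0 x hx)
    have hTx : ContinuousAt (fun x : X =>
        ppTrueNumeratorDu β Λ (f x) (g x) * (κ (f x / (f x + g x)) / (f x + g x)) +
          ppTrueNumerator β Λ (f x) (g x) * (-(κ' (f x / (f x + g x)) * (f x / (f x + g x)) + κ (f x / (f x + g x))) / (f x + g x) ^ 2)) x₀ :=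
      hT.continuousAt (hU.mem_nhds h0)
    have hev : (fun x : X => ppOneSidedKernelD1 β Λ κ κ' (f x) (g x)) =ᶠ[𝓝 x₀] fun x =>
        ppTrueNumeratorDu β Λ (f x) (g x) * (κ (f x / (f x + g x)) / (f x + g x)) +
          ppTrueNumerator β Λ (f x) (g x) * (-(κ' (f x / (f x + g x)) * (f x / (f x + g x)) + κ (f x / (f x + g x))) / (f x + g x) ^ 2) := by
      filter_upwards [hU.mem_nhds h0] with x hx
      have hx' : 0 < g x := hx
      unfold ppOneSidedKernelD1; rw [if_pos hx']
    exact hTx.congr_of_eventuallyEq hev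
  · -- near `x₀` the partner level is below the threshold: `K⁺′ = 0`
    have hV : IsOpen {x : X | g x < f x * (1 - t₁) / t₁} := isOpen_lt hg ((hf.mul continuous_const).div_const _)
    have hx₀ : x₀ ∈ {x : X | g x < f x * (1 - t₁) / t₁} := by
      have h1 : 0 < f x₀ * (1 - t₁) / t₁ := by have := hf0 x₀; positivity
      show g x₀ < f x₀ * (1 - t₁) / t₁
      linarith
    have hev : (fun x : X => ppOneSidedKernelD1 β Λ κ κ' (f x) (g x)) =ᶠ[𝓝 x₀] fun _ => (0 : ℝ) := by
      filter_upwards [hV.mem_nhds hx₀] with x hx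
      exact ppOneSidedKernelD1_eq_zero_of_le ht₀ hκs hκ's (hf0 x) (le_of_lt hx)
    exact continuousAt_const.congr_of_eventuallyEq hev

/-- **ROW `hKc` for the clamped family `Kr e := K⁺(max e c, ·)`** (`c > 0`; `= K⁺(e,·)` for `e ≥ c`): `p ↦ deriv (Kr p.1) p.2` is continuous on `ℝ × ℝ`.
[cite: BenfattoGiulianiMastropietro2006, §2.4 (2.36)] -/
theorem continuous_deriv_ppOneSidedKernel_clamp {β Λ : ℝ} (hβ : 0 < β) (hΛ : 0 < Λ) {B₁ : ℝ} (hB₁ : ∀ x, |deriv salmhoferCutoff x| ≤ B₁) {κ κ' : ℝ → ℝ}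
    (hκ : ∀ t, HasDerivAt κ (κ' t) t) (hκ'c : Continuous κ') {t₁ : ℝ} (ht₀ : 0 < t₁) (ht₁ : t₁ < 1) (hκs : ∀ t, t₁ ≤ t → κ t = 0)
    (hκ's : ∀ t, t₁ ≤ t → κ' t = 0) {c : ℝ} (hc : 0 < c) :
    Continuous fun p : ℝ × ℝ => deriv (fun v : ℝ => ppOneSidedKernel β Λ κ (max p.1 c) v) p.2 := by
  have hpos : ∀ p : ℝ × ℝ, 0 < max p.1 c := fun p => lt_max_of_lt_right hc
  have hd : (fun p : ℝ × ℝ => deriv (fun v : ℝ => ppOneSidedKernel β Λ κ (max p.1 c) v) p.2) =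
      fun p => ppOneSidedKernelD1 β Λ κ κ' (max p.1 c) p.2 :=
    funext fun p => deriv_ppOneSidedKernel hβ hΛ hB₁ hκ ht₀ ht₁ hκs (hpos p) p.2
  rw [hd]
  exact continuous_ppOneSidedKernelD1_comp hβ hΛ hB₁ hκ hκ'c ht₀ ht₁ hκs hκ's (continuous_fst.max continuous_const) continuous_snd hpos

end Summit.HubbardSuperconductivity.HubbardSuperconductivity.Theorems.C4a

end
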